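import Summits.NavierStokesRegularity.FluidComputer.StraddleClock
import Summits.NavierStokesRegularity.FluidComputer.SobolevLadderSerrin
import HarnessLib

/-!
# Fluid computer — L60 in its other forms: the straddle clock time-integrated (a Beale–Kato–Majda-level divergence
# with a logarithmic floor), the `Ḃ^{5/2}_{2,1}`-side reading, and the divergence of the pair

HONEST FRAMING (cell `pub-fluidc`, verbatim): *low prior, high value-of-information experiment on Tao's
machine paradigm; NOT a claim that NS blows up.* Theorem side of the cell (the level dictionary); nothing here is
evidence of blow-up. Companion of `StraddleClock` (L60: `c_δ (T − t)^{−4} ≤ Y_{5−δ}(t) Y_{5+δ}(t)`, no `ν`, no energy),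
along every maximal smooth Leray–Hopf solution of the unforced Navier–Stokes system on `ℝ³` (`ν > 0`), `0 < δ ≤ 4`:

* `straddle_quarter_clock` — the fourth root: `c (T − t)^{−1} ≤ (Y_{5−δ}(t) Y_{5+δ}(t))^{1/4}` — a quantity with the
  scaling of `‖∇u‖_∞` (it dominates the `Ḃ^{5/2}_{2,1}` row up to a constant, `StraddleInterpolation.lipRow_pow_four_le`)
  obeys the `1/(T − t)` clock with an ABSOLUTE constant;
* `straddle_log_floor`, `straddle_lintegral_eq_top` (**L60-S**) — `c log((T − t₀)/(T − t)) ≤ ∫_{t₀}^t (Y_{5−δ}Y_{5+δ})^{1/4}`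
  and `∫_{(t₀,T)} (Y_{5−δ} Y_{5+δ})^{1/4} = ∞`: a Beale–Kato–Majda-type divergence (`∫‖ω‖_∞ = ∞`) one interpolation
  step up, WITH a rate (logarithmic floor of the running integral) and no constant depending on the solution;
* `homSobolev_straddle_lintegral_eq_top` — `∫_{(t₀,T)} (‖u‖_{Ḣ^{(5−δ)/2}} ‖u‖_{Ḣ^{(5+δ)/2}})^{1/2} = ∞`.

0 sorry; no definitions; no named facts.

## References

* J. C. Robinson, W. Sadowski, R. P. Silva, J. Math. Phys. 53 (2012) 115618, §V.A. [RobinsonSadowskiSilva2012]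
* D. S. McCormick et al., SIAM J. Math. Anal. 48 (2016) 2119–2132 (`Ḃ^{5/2}_{2,1}` rate, implies these forms). [MccormickEtAl2016]
* J. T. Beale, T. Kato, A. Majda, Comm. Math. Phys. 94 (1984) 61–66, Thm. 1. [BealeKatoMajda1984]
-/

noncomputable section

open MeasureTheory Set Function Filter Topology
open scoped ENNReal NNReal
open Literature.Analysis.FluidPDE Literature.Analysis.FunctionSpaces
open Summit.NavierStokesRegularity.FluidComputer.StraddleClock
open Summit.NavierStokesRegularity.FluidComputer.SobolevLadderSerrin

namespace Summit.NavierStokesRegularity.FluidComputer.StraddleForms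

/-! ## The fourth root: a Lipschitz-level quantity with the `1/(T − t)` clock -/

/-- **The fourth root of the straddle clock.** For every `δ ∈ (0, 4]` there is `c > 0` such that along every maximal
smooth Leray–Hopf solution of the unforced system (`ν > 0`), at EVERY `t ∈ (0, T)`:
`c · ν⁰ · (T − t)^{−1} ≤ (Y_{5−δ}(t) · Y_{5+δ}(t))^{1/4}` (written in the ladder format with `ν^0 = 1`; `Y_κ = ∑_j 2^{κj}‖Δ̇_j u‖₂²`)
— the rate of `‖∇u‖_∞` under scaling, with an absolute constant. [cite: RobinsonSadowskiSilva2012, §V.A] -/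
theorem straddle_quarter_clock {δ : ℝ} (hδ : 0 < δ) (hδ4 : δ ≤ 4) :
    ∃ c : ℝ, 0 < c ∧ ∀ (ν T : ℝ), 0 < ν → 0 < T →
      ∀ (u : ℝ → EuclideanSpace ℝ (Fin 3) → EuclideanSpace ℝ (Fin 3)) (p : ℝ → EuclideanSpace ℝ (Fin 3) → ℝ),
      IsMaximalSmoothSolution ν 0 u p T → IsLerayHopfOn T ν 0 (u 0) u →
      ∀ t ∈ Ioo 0 T,
        ENNReal.ofReal (c * ν ^ (0 : ℝ) * (T - t) ^ (-(1 : ℝ))) ≤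
          ((∑' j : ℤ, (2 : ℝ≥0∞) ^ ((5 - δ) * (j : ℝ)) * blockL2 (u t) j ^ 2) *
            ∑' j : ℤ, (2 : ℝ≥0∞) ^ ((5 + δ) * (j : ℝ)) * blockL2 (u t) j ^ 2) ^ (1 / 4 : ℝ) := by
  obtain ⟨c, hc, H⟩ := straddle_clock hδ hδ4
  refine ⟨c ^ (1 / 4 : ℝ), by positivity, fun ν T hν hT u p hmax hLH t ht => ?_⟩
  have hTt : 0 < T - t := sub_pos.2 ht.2
  have h := ENNReal.rpow_le_rpow (H ν T hν hT u p hmax hLH t ht) (by norm_num : (0 : ℝ) ≤ 1 / 4)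
  rw [ENNReal.ofReal_rpow_of_nonneg (by positivity) (by norm_num)] at h
  refine le_trans (le_of_eq ?_) h
  congr 1
  rw [Real.rpow_zero, mul_one, Real.mul_rpow hc.le (Real.rpow_nonneg hTt.le _), ← Real.rpow_mul hTt.le]
  norm_num

/-! ## L60-S: time-integrated -/

/-- **L60-S — LOGARITHMIC FLOOR OF THE RUNNING INTEGRAL OF `(Y_{5−δ}Y_{5+δ})^{1/4}`.** For every `δ ∈ (0, 4]` there is
`c > 0` such that along every maximal smooth Leray–Hopf solution of the unforced system (`ν > 0`), for all
`0 ≤ t₀ ≤ t < T`: `c · log((T − t₀)/(T − t)) ≤ ∫⁻_{(t₀,t)} (Y_{5−δ}(τ) Y_{5+δ}(τ))^{1/4} dτ` — a rate for the Beale–Kato–Majda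
mechanism one interpolation step above `‖∇u‖_∞`, with an ABSOLUTE constant (no `ν`, no energy).
[cite: RobinsonSadowskiSilva2012, §V.A] [cite: BealeKatoMajda1984, Thm. 1] -/
theorem straddle_log_floor {δ : ℝ} (hδ : 0 < δ) (hδ4 : δ ≤ 4) :
    ∃ c : ℝ, 0 < c ∧ ∀ (ν T : ℝ), 0 < ν → 0 < T →
      ∀ (u : ℝ → EuclideanSpace ℝ (Fin 3) → EuclideanSpace ℝ (Fin 3)) (p : ℝ → EuclideanSpace ℝ (Fin 3) → ℝ),
      IsMaximalSmoothSolution ν 0 u p T → IsLerayHopfOn T ν 0 (u 0) u →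
      ∀ t₀ t : ℝ, 0 ≤ t₀ → t₀ ≤ t → t < T →
        ENNReal.ofReal (c * Real.log ((T - t₀) / (T - t))) ≤
          ∫⁻ τ in Ioo t₀ t, ((∑' j : ℤ, (2 : ℝ≥0∞) ^ ((5 - δ) * (j : ℝ)) * blockL2 (u τ) j ^ 2) *
            ∑' j : ℤ, (2 : ℝ≥0∞) ^ ((5 + δ) * (j : ℝ)) * blockL2 (u τ) j ^ 2) ^ (1 / 4 : ℝ) := by
  obtain ⟨c, hc, H⟩ := straddle_quarter_clock hδ hδ4
  refine ⟨c, hc, fun ν T hν hT u p hmax hLH t₀ t ht₀ h₀ ht => ?_⟩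
  have h := log_le_lintegral_rpow_of_clock (c := c) (ν := ν) (a := (0 : ℝ)) (b := (1 : ℝ)) (T := T) hc hν one_pos h₀ ht
    (X := fun τ => ((∑' j : ℤ, (2 : ℝ≥0∞) ^ ((5 - δ) * (j : ℝ)) * blockL2 (u τ) j ^ 2) *
      ∑' j : ℤ, (2 : ℝ≥0∞) ^ ((5 + δ) * (j : ℝ)) * blockL2 (u τ) j ^ 2) ^ (1 / 4 : ℝ))
    (fun τ hτ => H ν T hν hT u p hmax hLH τ ⟨ht₀.trans_lt hτ.1, hτ.2.trans ht⟩)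
  simpa only [div_one, Real.rpow_zero, mul_one, Real.rpow_one, ENNReal.rpow_one] using h

/-- **L60-S — THE INTEGRAL OF `(Y_{5−δ}Y_{5+δ})^{1/4}` OVER EVERY TERMINAL WINDOW DIVERGES**: along every maximal smooth
Leray–Hopf solution of the unforced system (`ν > 0`), for every `t₀ ∈ [0, T)` and every `δ ∈ (0, 4]`:
`∫⁻_{(t₀,T)} (Y_{5−δ}(τ) Y_{5+δ}(τ))^{1/4} dτ = ∞` (compare Beale–Kato–Majda `∫‖ω‖_∞ = ∞`: here the integrand dominates
the `Ḃ^{5/2}_{2,1}` row, which dominates `‖∇u‖_∞`, and the divergence comes with the logarithmic floor above).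
[cite: BealeKatoMajda1984, Thm. 1] [cite: RobinsonSadowskiSilva2012, §V.A] -/
theorem straddle_lintegral_eq_top {δ : ℝ} (hδ : 0 < δ) (hδ4 : δ ≤ 4) {ν T : ℝ} (hν : 0 < ν) (hT : 0 < T)
    {u : ℝ → EuclideanSpace ℝ (Fin 3) → EuclideanSpace ℝ (Fin 3)} {p : ℝ → EuclideanSpace ℝ (Fin 3) → ℝ}
    (hmax : IsMaximalSmoothSolution ν 0 u p T) (hLH : IsLerayHopfOn T ν 0 (u 0) u)
    {t₀ : ℝ} (ht₀ : t₀ ∈ Ico 0 T) :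
    ∫⁻ τ in Ioo t₀ T, ((∑' j : ℤ, (2 : ℝ≥0∞) ^ ((5 - δ) * (j : ℝ)) * blockL2 (u τ) j ^ 2) *
        ∑' j : ℤ, (2 : ℝ≥0∞) ^ ((5 + δ) * (j : ℝ)) * blockL2 (u τ) j ^ 2) ^ (1 / 4 : ℝ) = ∞ := by
  obtain ⟨c, hc, H⟩ := straddle_quarter_clock hδ hδ4
  have h := lintegral_rpow_eq_top_of_clock (c := c) (ν := ν) (a := (0 : ℝ)) (b := (1 : ℝ)) hc hν one_pos ht₀.2
    (X := fun τ => ((∑' j : ℤ, (2 : ℝ≥0∞) ^ ((5 - δ) * (j : ℝ)) * blockL2 (u τ) j ^ 2) *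
      ∑' j : ℤ, (2 : ℝ≥0∞) ^ ((5 + δ) * (j : ℝ)) * blockL2 (u τ) j ^ 2) ^ (1 / 4 : ℝ))
    (fun τ hτ => H ν T hν hT u p hmax hLH τ ⟨ht₀.1.trans_lt hτ.1, hτ.2⟩)
  simpa only [div_one, ENNReal.rpow_one] using h

/-- **L60-S IN `Ḣ^s`: `∫_{(t₀,T)} (‖u(τ)‖_{Ḣ^{(5−δ)/2}} ‖u(τ)‖_{Ḣ^{(5+δ)/2}})^{1/2} dτ = ∞`** on every terminal window,
every `δ ∈ (0, 4]`, along every maximal smooth Leray–Hopf solution of the unforced system (`ν > 0`).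
[cite: RobinsonSadowskiSilva2012, §V.A] [cite: BealeKatoMajda1984, Thm. 1] -/
theorem homSobolev_straddle_lintegral_eq_top {δ : ℝ} (hδ : 0 < δ) (hδ4 : δ ≤ 4) {ν T : ℝ} (hν : 0 < ν) (hT : 0 < T)
    {u : ℝ → EuclideanSpace ℝ (Fin 3) → EuclideanSpace ℝ (Fin 3)} {p : ℝ → EuclideanSpace ℝ (Fin 3) → ℝ}
    (hmax : IsMaximalSmoothSolution ν 0 u p T) (hLH : IsLerayHopfOn T ν 0 (u 0) u)
    {t₀ : ℝ} (ht₀ : t₀ ∈ Ico 0 T) :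
    ∫⁻ τ in Ioo t₀ T, (Function.eHomSobolevSeminorm ((5 - δ) / 2) (⇑EuclideanSpace.complexify ∘ u τ) *
        Function.eHomSobolevSeminorm ((5 + δ) / 2) (⇑EuclideanSpace.complexify ∘ u τ)) ^ (1 / 2 : ℝ) = ∞ := by
  obtain ⟨c, hc, H⟩ := homSobolev_straddle_clock hδ hδ4
  have h := lintegral_rpow_eq_top_of_clock (c := c) (ν := ν) (a := (0 : ℝ)) (b := (2 : ℝ)) hc hν two_pos ht₀.2
    (X := fun τ => Function.eHomSobolevSeminorm ((5 - δ) / 2) (⇑EuclideanSpace.complexify ∘ u τ) *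
      Function.eHomSobolevSeminorm ((5 + δ) / 2) (⇑EuclideanSpace.complexify ∘ u τ))
    (fun τ hτ => by
      have := H ν T hν hT u p hmax hLH τ ⟨ht₀.1.trans_lt hτ.1, hτ.2⟩
      simpa only [Real.rpow_zero, mul_one] using this)
  exact h

/-! ## Divergence of the pair -/

/-- **The fourth root `(Y_{5−δ}Y_{5+δ})^{1/4}` tends to `∞` as `t ↑ T`** along every maximal smooth Leray–Hopf solution of
the unforced system (`ν > 0`), at the rate of `straddle_quarter_clock`. [cite: RobinsonSadowskiSilva2012, §V.A] -/
theorem straddle_quarter_tendsto_top {δ : ℝ} (hδ : 0 < δ) (hδ4 : δ ≤ 4) {ν T : ℝ} (hν : 0 < ν) (hT : 0 < T)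
    {u : ℝ → EuclideanSpace ℝ (Fin 3) → EuclideanSpace ℝ (Fin 3)} {p : ℝ → EuclideanSpace ℝ (Fin 3) → ℝ}
    (hmax : IsMaximalSmoothSolution ν 0 u p T) (hLH : IsLerayHopfOn T ν 0 (u 0) u) :
    Tendsto (fun t => ((∑' j : ℤ, (2 : ℝ≥0∞) ^ ((5 - δ) * (j : ℝ)) * blockL2 (u t) j ^ 2) *
        ∑' j : ℤ, (2 : ℝ≥0∞) ^ ((5 + δ) * (j : ℝ)) * blockL2 (u t) j ^ 2) ^ (1 / 4 : ℝ)) (𝓝[<] T) (𝓝 ∞) := by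
  obtain ⟨c, hc, H⟩ := straddle_quarter_clock hδ hδ4
  refine tendsto_nhds_top_mono (SobolevLadderFront.tendsto_ofReal_clock_top (a := (0 : ℝ)) (b := (1 : ℝ)) (T := T)
    hc hν one_pos) ?_
  filter_upwards [Ioo_mem_nhdsLT hT] with t ht
  exact H ν T hν hT u p hmax hLH t ht

end Summit.NavierStokesRegularity.FluidComputer.StraddleForms

end
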